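import Summits.AtomisticToContinuum.HydrodynamicLimit.Theses.OneFlightGossipEngine
import Summits.AtomisticToContinuum.HydrodynamicLimit.Theorems.BoltzmannGreenKubo.Negative.PiStatics
import Summits.AtomisticToContinuum.HydrodynamicLimit.Theorems.BoltzmannGreenKubo.Negative.MomentumWitness
import Summits.AtomisticToContinuum.HydrodynamicLimit.Theorems.CollisionActivityTails.Negative.EquilibriumReduction
import Literature.MathematicalPhysics.KineticTheory.HardSphereTwoTimePressure

/-!
# `SuperExponentialEnergyTails` (stmt-AtomisticToContinuum-17701), negative knowledge 1: the rate family of SEET cannot be upgraded to a Gaussian one — tightness at `s = 0`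

Load-bearing / strengthening analysis of the crux
`Summit.AtomisticToContinuum.HydrodynamicLimit.Theses.OneFlightGossipEngine.SuperExponentialEnergyTails`
(SEET, rank 7 of route OneFlightGossipEngine) by the standing disprover
(`Cruxes/SuperExponentialEnergyTails/Disproof.lean`, refuter-cdisprove-stmt-AtomisticToContinuum-17701-0).

SEET asks, under the TRUE pre-shock law, for the empirical cubic velocity tail
`E[(N+1)⁻¹ Σᵢ ‖vᵢ(s)‖³ 1{‖vᵢ(s)‖ > K}] ≤ e^{-cK} + ε` for EVERY exponential rate `c > 0`
(`K ≥ K₀(c)`, eventually in `N`, uniformly in `s ≤ t`).  This file records, sorry-free: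

* `gaussianReal_Ioi_ge`: the one-dimensional Gaussian tail from below,
  `γ₁(K, ∞) ≥ φ(K + 1) = e^{-(K+1)²/2}/√(2π)` for `K ≥ 0`;
* `lintegral_cubicTail_time_zero_ge` (TIGHTNESS): under the homogeneous unit local Gibbs law
  (`a₀ = 1`, `u₀ = 0`, `θ₀ = 1`), for EVERY `σ ≤ 1/2`, EVERY `N`, EVERY hard-sphere flow and every
  level `K ≥ 0`, the crux functional at `s = 0` is at least `K³ e^{-(K+1)²/2}/√(2π)` — the velocity
  marginal is the product standard Gaussian (`map_velOf_localGibbsLaw`, coordinate law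
  `BoltzmannGreenKuboOrthMomentum.measurePreserving_coord`) and `Φ_N(0) = id` a.s.;
* `not_gaussianRate_homogeneous`: hence, for every flow family and every horizon `t ≥ 0`, the
  conclusion of SEET with the rate family `{e^{-cK} : c > 0}` replaced by the Gaussian family
  `{e^{-cK²} : c > 0}` FAILS (already `c = 1 > 1/(2θ₀)` fails at `s = 0`);
* `superGaussianEnergyTails_false`: the corresponding strengthening of the crux TEXT (verbatim,
  `c * K` ↦ `c * K ^ 2`, inlined in the theorem's type) is FALSE unconditionally — its hypotheses are
  dischargeable at constant profiles in the tree (flows exist, `flows_nonempty`; constant states are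
  classical hs-Euler solutions, `isHardSphereEulerSolution_const`; the `t = 0` law of large numbers,
  `constantProfileLLN_holds`).

MESSAGE for provers: SEET's rate family is the WEAKEST super-exponential class and is essentially
the most one can ask uniformly in the profiles' normalisation — the true `s = 0` decay is Gaussian
with the thermal rate `1/(2 sup θ₀)` (here `1/2`), no faster; any proof must produce a rate in `K`
that beats every exponential but it need not (and cannot, beyond `1/(2 sup θ₀)`) be Gaussian of a
prescribed rate.  The crux itself is NOT refuted (see the Disproof workfile).
-/

noncomputable section

open MeasureTheory ProbabilityTheory Filter Set Topology
open scoped ENNReal NNReal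

namespace Summit.AtomisticToContinuum.HydrodynamicLimit.Theorems

namespace SuperExponentialEnergyTailsNegative

open Literature.MathematicalPhysics.KineticTheory Literature.Analysis.FluidPDE
open BoltzmannGreenKuboOrthMomentum (velOf measurable_velOf map_velOf_localGibbsLaw measurePreserving_coord)

/-! ### One-dimensional Gaussian tail from below -/

/-- The standard Gaussian tail from below: `γ₁(K, ∞) ≥ e^{-(K+1)²/2}/√(2π)` for `K ≥ 0`
(restrict to `(K, K+1]`, on which the density is at least its value at `K + 1`). [folklore] -/
theorem gaussianReal_Ioi_ge {K : ℝ} (hK : 0 ≤ K) :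
    ENNReal.ofReal ((Real.sqrt (2 * Real.pi))⁻¹ * Real.exp (-(K + 1) ^ 2 / 2)) ≤
      gaussianReal 0 1 (Set.Ioi K) := by
  rw [gaussianReal_apply 0 one_ne_zero]
  calc ENNReal.ofReal ((Real.sqrt (2 * Real.pi))⁻¹ * Real.exp (-(K + 1) ^ 2 / 2))
      = ∫⁻ _ in Set.Ioc K (K + 1),
          ENNReal.ofReal ((Real.sqrt (2 * Real.pi))⁻¹ * Real.exp (-(K + 1) ^ 2 / 2)) := by
        rw [setLIntegral_const, Real.volume_Ioc, add_sub_cancel_left, ENNReal.ofReal_one, mul_one]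
    _ ≤ ∫⁻ x in Set.Ioc K (K + 1), gaussianPDF 0 1 x := by
        refine setLIntegral_mono' measurableSet_Ioc fun x hx => ?_
        have hx0 : 0 ≤ x := hK.trans hx.1.le
        have hsq : x ^ 2 ≤ (K + 1) ^ 2 := pow_le_pow_left₀ hx0 hx.2 2
        have hexp : Real.exp (-(K + 1) ^ 2 / 2) ≤ Real.exp (-x ^ 2 / 2) :=
          Real.exp_le_exp.2 (by linarith)
        rw [gaussianPDF]
        refine ENNReal.ofReal_le_ofReal ?_
        calc (Real.sqrt (2 * Real.pi))⁻¹ * Real.exp (-(K + 1) ^ 2 / 2)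
            ≤ (Real.sqrt (2 * Real.pi))⁻¹ * Real.exp (-x ^ 2 / 2) :=
              mul_le_mul_of_nonneg_left hexp (inv_nonneg.2 (Real.sqrt_nonneg _))
          _ = gaussianPDFReal 0 1 x := by simp [gaussianPDFReal]
    _ ≤ ∫⁻ x in Set.Ioi K, gaussianPDF 0 1 x := lintegral_mono_set Set.Ioc_subset_Ioi_self

/-- The coordinate half-space `{w | K < w j}` is measurable. [folklore] -/
theorem measurableSet_coord_gt (K : ℝ) (j : Fin 3) : MeasurableSet {w : V3 | K < w j} :=
  measurableSet_lt measurable_const (PiLp.continuous_apply 2 _ j).measurable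

/-- The standard Gaussian on `ℝ³` charges the coordinate half-space `{w | K < w j}` by at least
`e^{-(K+1)²/2}/√(2π)` (`K ≥ 0`). [folklore] -/
theorem stdGaussian_coord_gt_ge {K : ℝ} (hK : 0 ≤ K) (j : Fin 3) :
    ENNReal.ofReal ((Real.sqrt (2 * Real.pi))⁻¹ * Real.exp (-(K + 1) ^ 2 / 2)) ≤
      stdGaussian V3 {w : V3 | K < w j} := by
  have hmp := measurePreserving_coord j
  have h : stdGaussian V3 {w : V3 | K < w j} = gaussianReal 0 1 (Set.Ioi K) := by
    rw [← hmp.map_eq, Measure.map_apply hmp.measurable measurableSet_Ioi]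
    rfl
  rw [h]
  exact gaussianReal_Ioi_ge hK


/-! ### Tightness of the crux functional at `s = 0` under the homogeneous unit Gibbs law -/

/-- The event "the first velocity coordinate of sphere `i` exceeds `K`". -/
theorem measurableSet_coordEvent (N : ℕ) (K : ℝ) (i : Fin (N + 1)) :
    MeasurableSet {z : Config (N + 1) (Fin 3) T3 | K < (z i).2 0} :=
  (measurableSet_coord_gt K 0).preimage (measurable_pi_apply i).snd

/-- Under the homogeneous unit local Gibbs law every sphere's first velocity coordinate is a
standard Gaussian: `λ_N {K < (vᵢ)₀} = γ₃ {K < w₀}` (`σ ≤ 1/2`). [folklore] -/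
theorem localGibbsLaw_coordEvent {σ : ℝ} (hσ : σ ≤ 1 / 2) (N : ℕ) (Φ : HardSphereFlow (Torus.geometry (Fin 3)) (hsDiameter σ N) (N + 1)) (K : ℝ)
    (i : Fin (N + 1)) :
    localGibbsLaw σ (fun _ => 1) (fun _ => 0) (fun _ => 1) N Φ
        {z : Config (N + 1) (Fin 3) T3 | K < (z i).2 0} = stdGaussian V3 {w : V3 | K < w 0} := by
  have hS : MeasurableSet {w : Fin (N + 1) → V3 | K < w i 0} :=
    (measurableSet_coord_gt K 0).preimage (measurable_pi_apply i)
  have h1 : {z : Config (N + 1) (Fin 3) T3 | K < (z i).2 0} =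
      velOf ⁻¹' {w : Fin (N + 1) → V3 | K < w i 0} := rfl
  rw [h1, ← Measure.map_apply measurable_velOf hS, map_velOf_localGibbsLaw hσ N Φ]
  have hmp := MeasureTheory.measurePreserving_eval (fun _ : Fin (N + 1) => stdGaussian V3) i
  have h2 : {w : Fin (N + 1) → V3 | K < w i 0} = Function.eval i ⁻¹' {w : V3 | K < w 0} := rfl
  rw [h2, ← Measure.map_apply hmp.measurable (measurableSet_coord_gt K 0), hmp.map_eq]

/-- **TIGHTNESS of SEET's functional at the initial time.** Under the homogeneous unit local Gibbs
law (`a₀ = 1`, `u₀ = 0`, `θ₀ = 1`), for every `σ ≤ 1/2`, every `N`, every hard-sphere flow `Φ`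
and every level `K ≥ 0`:
`E_{λ_N}[(N+1)⁻¹ Σᵢ ‖vᵢ(Φ(0) z)‖³ 1{‖vᵢ(Φ(0) z)‖ > K}] ≥ K³ · e^{-(K+1)²/2}/√(2π)`
— the velocity marginal is `γ₃^{⊗(N+1)}` (`map_velOf_localGibbsLaw`), `Φ(0) = id` a.s.
(`ae_mem_good_localGibbsLaw`), `‖v‖ ≥ v₀`, and the one-dimensional tail bound
`gaussianReal_Ioi_ge`.  So the decay in the level of the crux functional is NO FASTER than the
thermal Gaussian `e^{-K²/(2θ)}` (here `θ = 1`). [folklore] -/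
theorem lintegral_cubicTail_time_zero_ge {σ : ℝ} (hσ : σ ≤ 1 / 2) (N : ℕ) (Φ : HardSphereFlow (Torus.geometry (Fin 3)) (hsDiameter σ N) (N + 1)) {K : ℝ}
    (hK : 0 ≤ K) :
    ENNReal.ofReal (K ^ 3 * ((Real.sqrt (2 * Real.pi))⁻¹ * Real.exp (-(K + 1) ^ 2 / 2))) ≤
      ∫⁻ z, ENNReal.ofReal (((N : ℝ) + 1)⁻¹ * ∑ i : Fin (N + 1),
          Set.indicator {v : V3 | K < ‖v‖} (fun v => ‖v‖ ^ 3) ((Φ.flow 0 z i).2))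
        ∂(localGibbsLaw σ (fun _ => 1) (fun _ => 0) (fun _ => 1) N Φ) := by
  set P := localGibbsLaw σ (fun _ => 1) (fun _ => 0) (fun _ => 1) N Φ with hP
  -- `Φ(0) = id` almost surely
  have hae : (fun z => ENNReal.ofReal (((N : ℝ) + 1)⁻¹ * ∑ i : Fin (N + 1),
        Set.indicator {v : V3 | K < ‖v‖} (fun v => ‖v‖ ^ 3) ((Φ.flow 0 z i).2))) =ᵐ[P]
      fun z => ENNReal.ofReal (((N : ℝ) + 1)⁻¹ * ∑ i : Fin (N + 1),
        Set.indicator {v : V3 | K < ‖v‖} (fun v => ‖v‖ ^ 3) ((z i).2)) := by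
    filter_upwards [ae_mem_good_localGibbsLaw σ (fun _ => 1) (fun _ => 0) (fun _ => 1) N Φ]
      with z hz
    rw [Φ.flow_zero z hz]
  rw [lintegral_congr_ae hae]
  -- the events `Aᵢ = {K < (vᵢ)₀}` and the constant `c = ofReal ((N+1)⁻¹ K³)`
  set A : Fin (N + 1) → Set (Config (N + 1) (Fin 3) T3) := fun i => {z | K < (z i).2 0} with hA
  have hAm : ∀ i, MeasurableSet (A i) := fun i => measurableSet_coordEvent N K i
  set c : ℝ≥0∞ := ENNReal.ofReal (((N : ℝ) + 1)⁻¹ * K ^ 3) with hc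
  -- pointwise lower bound by `Σᵢ c · 1_{Aᵢ}`
  have hpt : ∀ z : Config (N + 1) (Fin 3) T3,
      ∑ i : Fin (N + 1), c * (A i).indicator 1 z ≤
        ENNReal.ofReal (((N : ℝ) + 1)⁻¹ * ∑ i : Fin (N + 1),
          Set.indicator {v : V3 | K < ‖v‖} (fun v => ‖v‖ ^ 3) ((z i).2)) := by
    intro z
    have hnn : ∀ i ∈ (Finset.univ : Finset (Fin (N + 1))),
        0 ≤ ((N : ℝ) + 1)⁻¹ * Set.indicator {v : V3 | K < ‖v‖} (fun v => ‖v‖ ^ 3) ((z i).2) :=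
      fun i _ => mul_nonneg (by positivity) (Set.indicator_nonneg (fun v _ => by positivity) _)
    rw [Finset.mul_sum, ENNReal.ofReal_sum_of_nonneg hnn]
    refine Finset.sum_le_sum fun i _ => ?_
    by_cases hz : z ∈ A i
    · have hzK : K < (z i).2 0 := hz
      have hnorm : K < ‖(z i).2‖ :=
        hzK.trans_le ((le_abs_self _).trans
          ((Real.norm_eq_abs _).symm.le.trans (PiLp.norm_apply_le ((z i).2) 0)))
      rw [Set.indicator_of_mem hz, Pi.one_apply, mul_one,
        Set.indicator_of_mem (show (z i).2 ∈ {v : V3 | K < ‖v‖} from hnorm), hc]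
      refine ENNReal.ofReal_le_ofReal (mul_le_mul_of_nonneg_left ?_ (by positivity))
      exact pow_le_pow_left₀ hK hnorm.le 3
    · rw [Set.indicator_of_notMem hz, mul_zero]
      exact bot_le
  -- each `Aᵢ` has the probability of the one-dimensional Gaussian half-line
  have hprob : ∀ i, P (A i) = stdGaussian V3 {w : V3 | K < w 0} := fun i =>
    localGibbsLaw_coordEvent hσ N Φ K i
  have hq : ENNReal.ofReal ((Real.sqrt (2 * Real.pi))⁻¹ * Real.exp (-(K + 1) ^ 2 / 2)) ≤
      stdGaussian V3 {w : V3 | K < w 0} := stdGaussian_coord_gt_ge hK 0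
  -- integrate the lower bound
  have hsum : ∫⁻ z, ∑ i : Fin (N + 1), c * (A i).indicator 1 z ∂P =
      ENNReal.ofReal (K ^ 3) * stdGaussian V3 {w : V3 | K < w 0} := by
    rw [lintegral_finsetSum _ fun i _ => (measurable_one.indicator (hAm i)).const_mul c]
    simp_rw [lintegral_const_mul c (measurable_one.indicator (hAm _)), lintegral_indicator_one (hAm _),
      hprob, Finset.sum_const, Finset.card_univ, Fintype.card_fin, nsmul_eq_mul]
    rw [← mul_assoc, hc]
    congr 1
    have hN : (0 : ℝ) < (N : ℝ) + 1 := by positivity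
    rw [show ((N + 1 : ℕ) : ℝ≥0∞) = ENNReal.ofReal ((N : ℝ) + 1) by
        rw [← ENNReal.ofReal_natCast]; push_cast; rfl,
      ← ENNReal.ofReal_mul (by positivity)]
    congr 1
    field_simp
  calc ENNReal.ofReal (K ^ 3 * ((Real.sqrt (2 * Real.pi))⁻¹ * Real.exp (-(K + 1) ^ 2 / 2)))
      = ENNReal.ofReal (K ^ 3) *
          ENNReal.ofReal ((Real.sqrt (2 * Real.pi))⁻¹ * Real.exp (-(K + 1) ^ 2 / 2)) :=
        ENNReal.ofReal_mul (by positivity)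
    _ ≤ ENNReal.ofReal (K ^ 3) * stdGaussian V3 {w : V3 | K < w 0} := mul_le_mul' le_rfl hq
    _ = ∫⁻ z, ∑ i : Fin (N + 1), c * (A i).indicator 1 z ∂P := hsum.symm
    _ ≤ _ := lintegral_mono hpt

/-! ### The Gaussian-rate strengthening fails, flow-wise and as a crux text -/

/-- The numerical heart: for `K ≥ 3`, `e^{-K²} < K³ e^{-(K+1)²/2}/√(2π)`. [folklore] -/
theorem exp_neg_sq_lt_lowerBound {K : ℝ} (hK3 : 3 ≤ K) :
    Real.exp (-(1 * K ^ 2)) < K ^ 3 * ((Real.sqrt (2 * Real.pi))⁻¹ * Real.exp (-(K + 1) ^ 2 / 2)) := by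
  have hexp_lt : Real.exp (-(1 * K ^ 2)) < Real.exp (-(K + 1) ^ 2 / 2) :=
    Real.exp_lt_exp.2 (by nlinarith [mul_self_nonneg (K - 3)])
  have hcoef : 1 ≤ K ^ 3 * (Real.sqrt (2 * Real.pi))⁻¹ := by
    have h27 : (27 : ℝ) ≤ K ^ 3 := by
      have := pow_le_pow_left₀ (by norm_num : (0 : ℝ) ≤ 3) hK3 3
      norm_num at this
      exact this
    have hs : Real.sqrt (2 * Real.pi) < 3 := by
      rw [Real.sqrt_lt' (by norm_num : (0 : ℝ) < 3)]
      nlinarith [Real.pi_lt_four]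
    have hs0 : 0 < Real.sqrt (2 * Real.pi) := Real.sqrt_pos.2 (by positivity)
    rw [← div_eq_mul_inv, le_div_iff₀ hs0]
    linarith
  calc Real.exp (-(1 * K ^ 2)) < Real.exp (-(K + 1) ^ 2 / 2) := hexp_lt
    _ = 1 * Real.exp (-(K + 1) ^ 2 / 2) := (one_mul _).symm
    _ ≤ (K ^ 3 * (Real.sqrt (2 * Real.pi))⁻¹) * Real.exp (-(K + 1) ^ 2 / 2) :=
        mul_le_mul_of_nonneg_right hcoef (Real.exp_pos _).le
    _ = K ^ 3 * ((Real.sqrt (2 * Real.pi))⁻¹ * Real.exp (-(K + 1) ^ 2 / 2)) := mul_assoc _ _ _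

/-- **The Gaussian-rate family is false, for every flow family** (natural strengthening of SEET
refuted): under the homogeneous unit local Gibbs law, `σ ≤ 1/2`, the conclusion of SEET with
`e^{-cK}` replaced by `e^{-cK²}` fails for EVERY family of hard-sphere flows and every horizon
`t ≥ 0` — at rate `c = 1`, level `K = max K₀ 3`, accuracy `ε = (L - e^{-K²})/2`, time `s = 0`,
the tightness bound `lintegral_cubicTail_time_zero_ge` exceeds the claimed `e^{-K²} + ε`. [folklore] -/
theorem not_gaussianRate_homogeneous {σ : ℝ} (hσ : σ ≤ 1 / 2) (Φ : (N : ℕ) → HardSphereFlow (Torus.geometry (Fin 3)) (hsDiameter σ N) (N + 1)) {t : ℝ}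
    (ht : 0 ≤ t) :
    ¬ (∀ c : ℝ, 0 < c → ∃ K₀ : ℝ, 0 < K₀ ∧ ∀ K : ℝ, K₀ ≤ K → ∀ ε : ℝ, 0 < ε →
        ∃ N₀ : ℕ, ∀ N : ℕ, N₀ ≤ N → ∀ s ∈ Set.Icc 0 t,
          ∫⁻ z, ENNReal.ofReal (((N : ℝ) + 1)⁻¹ * ∑ i : Fin (N + 1),
              Set.indicator {v : V3 | K < ‖v‖} (fun v => ‖v‖ ^ 3) (((Φ N).flow s z i).2))
            ∂(localGibbsLaw σ (fun _ => 1) (fun _ => 0) (fun _ => 1) N (Φ N)) ≤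
            ENNReal.ofReal (Real.exp (-(c * K ^ 2)) + ε)) := by
  intro h
  obtain ⟨K₀, -, hK⟩ := h 1 one_pos
  have hK0K : K₀ ≤ max K₀ 3 := le_max_left _ _
  have hK3 : (3 : ℝ) ≤ max K₀ 3 := le_max_right _ _
  have hKnn : (0 : ℝ) ≤ max K₀ 3 := by linarith
  have hL := exp_neg_sq_lt_lowerBound hK3
  obtain ⟨N₀, hN⟩ := hK (max K₀ 3) hK0K
    ((max K₀ 3 ^ 3 * ((Real.sqrt (2 * Real.pi))⁻¹ * Real.exp (-(max K₀ 3 + 1) ^ 2 / 2)) -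
      Real.exp (-(1 * max K₀ 3 ^ 2))) / 2) (by linarith)
  have hbound := hN N₀ le_rfl 0 ⟨le_rfl, ht⟩
  have hlow := lintegral_cubicTail_time_zero_ge hσ N₀ (Φ N₀) hKnn
  have hlt : ENNReal.ofReal (Real.exp (-(1 * max K₀ 3 ^ 2)) +
      (max K₀ 3 ^ 3 * ((Real.sqrt (2 * Real.pi))⁻¹ * Real.exp (-(max K₀ 3 + 1) ^ 2 / 2)) -
        Real.exp (-(1 * max K₀ 3 ^ 2))) / 2) <
      ENNReal.ofReal (max K₀ 3 ^ 3 * ((Real.sqrt (2 * Real.pi))⁻¹ *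
        Real.exp (-(max K₀ 3 + 1) ^ 2 / 2))) :=
    (ENNReal.ofReal_lt_ofReal_iff (by linarith [Real.exp_pos (-(1 * max K₀ 3 ^ 2))])).2
      (by linarith)
  exact absurd (hlow.trans hbound) (not_le.2 hlt)

/-- **The Gaussian-rate strengthening of the crux TEXT is FALSE, unconditionally.** The negated
statement is `SuperExponentialEnergyTails` verbatim with the exponential rate family
`Real.exp (-(c * K))` replaced by the Gaussian family `Real.exp (-(c * K ^ 2))` ("super-exponential"
sharpened to "Gaussian at every rate"; recorded so that no planner files it). At the homogeneous unit
profile all hypotheses of the text are dischargeable in the tree — hard-sphere flow families exist for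
`0 < σ < 1/2` (`CollisionActivityTailsEquilibrium.flows_nonempty`, Alexander's theorem), constant
states are classical hs-Euler solutions on `[0, 1)` (`DenseExcursionUntied.isHardSphereEulerSolution_const`)
and the `t = 0` law of large numbers holds with a constant density
(`CollisionActivityTailsEquilibrium.constantProfileLLN_holds`) — and the conclusion fails at
`t = s = 0` by `not_gaussianRate_homogeneous`. -/
theorem superGaussianEnergyTails_false :
    ¬ (∀ (a₀ θ₀ : T3 → ℝ) (u₀ : T3 → V3), Continuous a₀ → Continuous θ₀ → Continuous u₀ →
    (∀ x, 0 < a₀ x) → (∀ x, 0 < θ₀ x) → ∃ σ₀ : ℝ, 0 < σ₀ ∧ ∀ σ : ℝ, 0 < σ → σ < σ₀ →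
    ∀ (T : ℝ) (ρ θ : ℝ → T3 → ℝ) (u : ℝ → T3 → V3), IsHardSphereEulerSolution σ T ρ u θ →
    ∀ Φ : (N : ℕ) → HardSphereFlow (Torus.geometry (Fin 3)) (hsDiameter σ N) (N + 1),
    TendstoHydroFieldsAt (fun N => localGibbsLaw σ a₀ u₀ θ₀ N (Φ N)) Φ ρ u θ 0 →
    ∀ t ∈ Set.Ico 0 T, ∀ c : ℝ, 0 < c → ∃ K₀ : ℝ, 0 < K₀ ∧ ∀ K : ℝ, K₀ ≤ K → ∀ ε : ℝ, 0 < ε →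
    ∃ N₀ : ℕ, ∀ N : ℕ, N₀ ≤ N → ∀ s ∈ Set.Icc 0 t,
      ∫⁻ z, ENNReal.ofReal (((N : ℝ) + 1)⁻¹ * ∑ i : Fin (N + 1),
          Set.indicator {v : V3 | K < ‖v‖} (fun v => ‖v‖ ^ 3) (((Φ N).flow s z i).2))
        ∂(localGibbsLaw σ a₀ u₀ θ₀ N (Φ N)) ≤ ENNReal.ofReal (Real.exp (-(c * K ^ 2)) + ε)) := by
  intro h
  obtain ⟨σ₀, hσ₀, H⟩ := h (fun _ => 1) (fun _ => 1) (fun _ => 0) continuous_const continuous_const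
    continuous_const (fun _ => one_pos) (fun _ => one_pos)
  obtain ⟨σ₁, hσ₁, hl⟩ :=
    CollisionActivityTailsEquilibrium.constantProfileLLN_holds 1 1 (0 : V3) one_pos one_pos
  have hm0 : min (min σ₀ σ₁) (1 / 2) ≤ σ₀ := (min_le_left _ _).trans (min_le_left _ _)
  have hm1 : min (min σ₀ σ₁) (1 / 2) ≤ σ₁ := (min_le_left _ _).trans (min_le_right _ _)
  have hmh : min (min σ₀ σ₁) (1 / 2) ≤ 1 / 2 := min_le_right _ _
  have hmpos : 0 < min (min σ₀ σ₁) (1 / 2) := lt_min (lt_min hσ₀ hσ₁) one_half_pos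
  have hσpos : 0 < min (min σ₀ σ₁) (1 / 2) / 2 := by positivity
  have hσ0 : min (min σ₀ σ₁) (1 / 2) / 2 < σ₀ := by linarith
  have hσ1 : min (min σ₀ σ₁) (1 / 2) / 2 < σ₁ := by linarith
  have hσh : min (min σ₀ σ₁) (1 / 2) / 2 < 1 / 2 := by linarith
  obtain ⟨r, hr, hlln⟩ := hl _ hσpos hσ1
  obtain ⟨Φ⟩ := CollisionActivityTailsEquilibrium.flows_nonempty hσpos hσh
  have hE := DenseExcursionUntied.isHardSphereEulerSolution_const (min (min σ₀ σ₁) (1 / 2) / 2) 1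
    (0 : V3) hr one_pos
  have key := H _ hσpos hσ0 1 (fun _ _ => r) (fun _ _ => 1) (fun _ _ => 0) hE Φ (hlln Φ) 0
    ⟨le_rfl, one_pos⟩
  exact not_gaussianRate_homogeneous hσh.le Φ le_rfl key

end SuperExponentialEnergyTailsNegative

end Summit.AtomisticToContinuum.HydrodynamicLimit.Theorems

end
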